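import Mathlib
import HarnessLib
import Summits.NavierStokesRegularity.NavierStokesRegularity.Theorems.PoloidalWindowDoorPoloidalWindowRigidityZShockSlopeSmoothCutoff

/-!
# Crux K2 `PoloidalWindowRigidity` (stmt-NavierStokesRegularity-19708), line `z_shock` — R3 infrastructure: the VALUE INTERVAL of a
# continuous field on a truncated solid cone, and the smooth slope function ON THE CONE

`--supports stmt-NavierStokesRegularity-19708 --as helper` (leafhand-ns-poloidalwindowdoor-3 g6, cell decomp-ns, 2026-08-31).
**No stub and no summit is closed by this file; Navier–Stokes regularity is NOT proved here (rung 0).**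

WHY THIS FILE.  Last link of the glue between the typed R3 entrance and the energy files.  `…ZShockHeightEvolution.heightEvolution_of_class_autonomy`
gives a slope function `G` analytic AT THE VALUES of the slice on a non-degenerate component `Ω`; `…ZShockSlopeSmoothCutoff.exists_contDiff_localisation`
turns analyticity at every point of a compact INTERVAL `[α, β]` into a globally smooth `G̃` agreeing with `G` (with its derivative) near
`[α, β]`; the cone-local energy files (`…ZShockWaveLocalEnergyLocal`) quantify over the truncated solid cone
`{(s, y) : t₀ ≤ s ≤ t, ‖y‖ ≤ √(1+ρ²) + c(t − s) + 1}`.  This file shows that the values of a jointly continuous field on that cone FORM such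
an interval and packages the consequence:

* `isClosed_solidCone`, `isBounded_solidCone`, `isCompact_solidCone`, `convex_solidCone`, `mem_solidCone_apex` (`(t, 0)` lies in it);
* `exists_value_Icc_of_solidCone` — for `W` jointly continuous there are `α ≤ β` with `W(cone) ⊆ [α, β]` and every `r ∈ [α, β]` attained on
  the cone (extreme values on a compact set + intermediate values along a segment, the cone being convex);
* `exists_energy_constants_on_solidCone` — if `γ(W) > 0` on the cone (strict hyperbolicity) there are `c, K ≥ 0` with `0 ≤ γ(W) ≤ c²`,
  `|γ'(W)∂ₛW| ≤ Kγ(W)` on the cone (the three cone-local hypotheses of `…ZShockWaveLocalEnergyLocal`);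
* `exists_smooth_slope_on_solidCone` — if `G` is analytic at `W(s, y)` for every cone point, there is `G̃ ∈ C^∞(ℝ)` with `G̃ = G`,
  `deriv G̃ = deriv G` and `HasDerivAt G̃ (deriv G (W s y)) (W s y)` at every cone point: the globally smooth `γ = −G̃` the energy files take,
  with the equation on the cone unchanged.

Elementary; Mathlib + `…ZShockSlopeSmoothCutoff`.  Proves no rigidity. [folklore]
-/

noncomputable section

namespace Summit.NavierStokesRegularity.NavierStokesRegularity.Theorems.PoloidalWindowDoorPoloidalWindowRigidityZShockConeValues

-- the problem directory repeats the summit name (`NavierStokesRegularity/NavierStokesRegularity`)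
set_option linter.dupNamespace false

open Set Filter Topology Metric Function Bornology
open scoped ContDiff
open Summit.NavierStokesRegularity.NavierStokesRegularity.Theorems.PoloidalWindowDoorPoloidalWindowRigidityZShockSlopeSmoothCutoff

variable {n : ℕ}

/-! ### The truncated solid cone as a subset of `ℝ × ℝⁿ` -/

/-- The truncated solid cone `{(s, y) : t₀ ≤ s ≤ t, ‖y‖ ≤ √(1+ρ²) + c(t − s) + 1}` is closed. [folklore] -/
theorem isClosed_solidCone (c t₀ t ρ : ℝ) :
    IsClosed {p : ℝ × EuclideanSpace ℝ (Fin n) | p.1 ∈ Icc t₀ t ∧ ‖p.2‖ ≤ √(1 + ρ ^ 2) + c * (t - p.1) + 1} :=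
  (isClosed_Icc.preimage continuous_fst).inter
    (isClosed_le (continuous_norm.comp continuous_snd) (by fun_prop))

/-- The truncated solid cone is bounded. [folklore] -/
theorem isBounded_solidCone (c t₀ t ρ : ℝ) :
    IsBounded {p : ℝ × EuclideanSpace ℝ (Fin n) | p.1 ∈ Icc t₀ t ∧ ‖p.2‖ ≤ √(1 + ρ ^ 2) + c * (t - p.1) + 1} := by
  refine (isBounded_closedBall (x := (0 : ℝ × EuclideanSpace ℝ (Fin n)))
    (r := max (max |t₀| |t|) (√(1 + ρ ^ 2) + |c| * (|t| + max |t₀| |t|) + 1))).subset fun p hp => ?_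
  obtain ⟨⟨h1, h2⟩, h3⟩ := hp
  rw [mem_closedBall, dist_zero_right, Prod.norm_def]
  refine max_le_max ?_ ?_
  · rw [Real.norm_eq_abs, abs_le]
    constructor
    · linarith [neg_abs_le t₀, le_max_left |t₀| |t|]
    · linarith [le_abs_self t, le_max_right |t₀| |t|]
  · have hs : |p.1| ≤ max |t₀| |t| := by
      rw [abs_le]
      constructor
      · linarith [neg_abs_le t₀, le_max_left |t₀| |t|]
      · linarith [le_abs_self t, le_max_right |t₀| |t|]
    have hct : c * (t - p.1) ≤ |c| * (|t| + max |t₀| |t|) := by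
      calc c * (t - p.1) ≤ |c * (t - p.1)| := le_abs_self _
        _ = |c| * |t - p.1| := abs_mul _ _
        _ ≤ |c| * (|t| + max |t₀| |t|) := by
            refine mul_le_mul_of_nonneg_left ?_ (abs_nonneg c)
            calc |t - p.1| ≤ |t| + |p.1| := abs_sub _ _
              _ ≤ |t| + max |t₀| |t| := by linarith
    linarith

/-- The truncated solid cone is compact. [folklore] -/
theorem isCompact_solidCone (c t₀ t ρ : ℝ) :
    IsCompact {p : ℝ × EuclideanSpace ℝ (Fin n) | p.1 ∈ Icc t₀ t ∧ ‖p.2‖ ≤ √(1 + ρ ^ 2) + c * (t - p.1) + 1} :=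
  isCompact_of_isClosed_isBounded (isClosed_solidCone c t₀ t ρ) (isBounded_solidCone c t₀ t ρ)

/-- The truncated solid cone is convex (for any speed `c`: `‖y‖ + c s` is convex). [folklore] -/
theorem convex_solidCone (c t₀ t ρ : ℝ) :
    Convex ℝ {p : ℝ × EuclideanSpace ℝ (Fin n) | p.1 ∈ Icc t₀ t ∧ ‖p.2‖ ≤ √(1 + ρ ^ 2) + c * (t - p.1) + 1} := by
  intro p hp q hq a b ha hb hab
  obtain ⟨⟨hp1, hp2⟩, hp3⟩ := hp
  obtain ⟨⟨hq1, hq2⟩, hq3⟩ := hq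
  simp only [mem_setOf_eq, Prod.fst_add, Prod.snd_add, Prod.smul_fst, Prod.smul_snd, smul_eq_mul, mem_Icc]
  have h1 : a * t₀ ≤ a * p.1 := mul_le_mul_of_nonneg_left hp1 ha
  have h2 : b * t₀ ≤ b * q.1 := mul_le_mul_of_nonneg_left hq1 hb
  have h3 : a * p.1 ≤ a * t := mul_le_mul_of_nonneg_left hp2 ha
  have h4 : b * q.1 ≤ b * t := mul_le_mul_of_nonneg_left hq2 hb
  have hb' : b = 1 - a := by linarith
  refine ⟨⟨by rw [hb'] at h2 ⊢; nlinarith, by rw [hb'] at h4 ⊢; nlinarith⟩, ?_⟩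
  calc ‖a • p.2 + b • q.2‖ ≤ ‖a • p.2‖ + ‖b • q.2‖ := norm_add_le _ _
    _ = a * ‖p.2‖ + b * ‖q.2‖ := by
        rw [norm_smul, norm_smul, Real.norm_of_nonneg ha, Real.norm_of_nonneg hb]
    _ ≤ a * (√(1 + ρ ^ 2) + c * (t - p.1) + 1) + b * (√(1 + ρ ^ 2) + c * (t - q.1) + 1) := by
        gcongr
    _ = √(1 + ρ ^ 2) + c * (t - (a * p.1 + b * q.1)) + 1 := by
        rw [hb']
        ring

/-- The apex point `(t, 0)` lies in the truncated solid cone (`t₀ ≤ t`). [folklore] -/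
theorem mem_solidCone_apex {c t₀ t : ℝ} (ht : t₀ ≤ t) (ρ : ℝ) :
    ((t, (0 : EuclideanSpace ℝ (Fin n))) : ℝ × EuclideanSpace ℝ (Fin n)) ∈
      {p : ℝ × EuclideanSpace ℝ (Fin n) | p.1 ∈ Icc t₀ t ∧ ‖p.2‖ ≤ √(1 + ρ ^ 2) + c * (t - p.1) + 1} := by
  refine ⟨⟨ht, le_rfl⟩, ?_⟩
  simp only [norm_zero, sub_self, mul_zero, add_zero]
  positivity

/-! ### The value interval of a jointly continuous field on the cone -/

/-- **The values of a jointly continuous field on the truncated solid cone form a compact interval**: for `W : ℝ → ℝⁿ → ℝ` with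
`uncurry W` continuous, `t₀ ≤ t`, there are `α ≤ β` such that `W(s, y) ∈ [α, β]` at every cone point and every `r ∈ [α, β]` is a
value `W(s, y)` at some cone point (extreme value theorem on the compact cone; intermediate values along the segment between the extremal
points, which stays in the convex cone). [folklore] -/
theorem exists_value_Icc_of_solidCone {W : ℝ → EuclideanSpace ℝ (Fin n) → ℝ} (hW : Continuous (uncurry W))
    {c t₀ t : ℝ} (ht : t₀ ≤ t) (ρ : ℝ) :
    ∃ α β : ℝ, α ≤ β ∧
      (∀ s ∈ Icc t₀ t, ∀ y : EuclideanSpace ℝ (Fin n), ‖y‖ ≤ √(1 + ρ ^ 2) + c * (t - s) + 1 → W s y ∈ Icc α β) ∧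
      (∀ r ∈ Icc α β, ∃ s ∈ Icc t₀ t, ∃ y : EuclideanSpace ℝ (Fin n),
        ‖y‖ ≤ √(1 + ρ ^ 2) + c * (t - s) + 1 ∧ W s y = r) := by
  set K : Set (ℝ × EuclideanSpace ℝ (Fin n)) :=
    {p | p.1 ∈ Icc t₀ t ∧ ‖p.2‖ ≤ √(1 + ρ ^ 2) + c * (t - p.1) + 1} with hK
  have hKc : IsCompact K := isCompact_solidCone c t₀ t ρ
  have hKne : K.Nonempty := ⟨(t, 0), mem_solidCone_apex ht ρ⟩
  have hKconv : Convex ℝ K := convex_solidCone c t₀ t ρ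
  obtain ⟨pm, hpm, hmin⟩ := hKc.exists_isMinOn hKne hW.continuousOn
  obtain ⟨pM, hpM, hmax⟩ := hKc.exists_isMaxOn hKne hW.continuousOn
  refine ⟨uncurry W pm, uncurry W pM, hmin hpM, fun s hs y hy => ?_, fun r hr => ?_⟩
  · have hmem : ((s, y) : ℝ × EuclideanSpace ℝ (Fin n)) ∈ K := ⟨hs, hy⟩
    exact ⟨hmin hmem, hmax hmem⟩
  · -- intermediate values along the segment from `pm` to `pM`
    set g : ℝ → ℝ := fun τ => uncurry W (pm + τ • (pM - pm)) with hg
    have hgc : Continuous g := hW.comp (by fun_prop)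
    have hg0 : g 0 = uncurry W pm := by simp [hg]
    have hg1 : g 1 = uncurry W pM := by simp [hg]
    have hr' : r ∈ Icc (g 0) (g 1) := by rw [hg0, hg1]; exact hr
    obtain ⟨τ, hτ, hτr⟩ := intermediate_value_Icc zero_le_one hgc.continuousOn hr'
    have hmem : pm + τ • (pM - pm) ∈ K := hKconv.add_smul_sub_mem hpm hpM hτ
    refine ⟨(pm + τ • (pM - pm)).1, hmem.1, (pm + τ • (pM - pm)).2, hmem.2, ?_⟩
    exact hτr

/-! ### Uniform bounds on the cone from strict hyperbolicity -/

/-- **The cone-local constants of the energy inequality from strict hyperbolicity.**  Let `W : ℝ → ℝⁿ → ℝ` be jointly continuous with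
jointly continuous height derivative `∂ₛW`, `γ : ℝ → ℝ` continuous with continuous derivative, `t₀ ≤ t`, and suppose `γ(W) > 0` at every
point of the truncated solid cone (strict hyperbolicity there).  Then there are constants `c, K ≥ 0` with `0 ≤ γ(W) ≤ c²` and
`|γ'(W)·∂ₛW| ≤ K·γ(W)` at every cone point — the hypotheses `hγ0`, `hγc`, `hγK` of
`…ZShockWaveLocalEnergyLocal.waveEnergy_closedBall_le_exp_mul_local` (extreme values of continuous functions on the compact cone). [folklore] -/
theorem exists_energy_constants_on_solidCone {W : ℝ → EuclideanSpace ℝ (Fin n) → ℝ} (hW : Continuous (uncurry W))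
    (hWs : Continuous (uncurry fun s y => deriv (fun s'' => W s'' y) s))
    {γ : ℝ → ℝ} (hγ : Continuous γ) (hγ' : Continuous (deriv γ)) {c₀ t₀ t : ℝ} (ht : t₀ ≤ t) (ρ : ℝ)
    (hpos : ∀ s ∈ Icc t₀ t, ∀ y : EuclideanSpace ℝ (Fin n), ‖y‖ ≤ √(1 + ρ ^ 2) + c₀ * (t - s) + 1 → 0 < γ (W s y)) :
    ∃ c K : ℝ, 0 ≤ c ∧ 0 ≤ K ∧
      ∀ s ∈ Icc t₀ t, ∀ y : EuclideanSpace ℝ (Fin n), ‖y‖ ≤ √(1 + ρ ^ 2) + c₀ * (t - s) + 1 →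
        0 ≤ γ (W s y) ∧ γ (W s y) ≤ c ^ 2 ∧ |deriv γ (W s y) * deriv (fun s'' => W s'' y) s| ≤ K * γ (W s y) := by
  set C : Set (ℝ × EuclideanSpace ℝ (Fin n)) :=
    {p | p.1 ∈ Icc t₀ t ∧ ‖p.2‖ ≤ √(1 + ρ ^ 2) + c₀ * (t - p.1) + 1} with hC
  have hCc : IsCompact C := isCompact_solidCone c₀ t₀ t ρ
  have hCne : C.Nonempty := ⟨(t, 0), mem_solidCone_apex ht ρ⟩
  -- the two continuous functions on the cone
  have hf : Continuous fun p : ℝ × EuclideanSpace ℝ (Fin n) => γ (uncurry W p) := hγ.comp hW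
  have hg : Continuous fun p : ℝ × EuclideanSpace ℝ (Fin n) =>
      |deriv γ (uncurry W p) * (uncurry (fun s y => deriv (fun s'' => W s'' y) s)) p| :=
    ((hγ'.comp hW).mul hWs).abs
  obtain ⟨pm, hpm, hmin⟩ := hCc.exists_isMinOn hCne hf.continuousOn
  obtain ⟨pM, hpM, hmax⟩ := hCc.exists_isMaxOn hCne hf.continuousOn
  obtain ⟨pG, hpG, hGmax⟩ := hCc.exists_isMaxOn hCne hg.continuousOn
  have hm : 0 < γ (uncurry W pm) := hpos pm.1 hpm.1 pm.2 hpm.2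
  set m : ℝ := γ (uncurry W pm) with hmdef
  set M : ℝ := γ (uncurry W pM) with hMdef
  set L : ℝ := |deriv γ (uncurry W pG) * (uncurry (fun s y => deriv (fun s'' => W s'' y) s)) pG| with hLdef
  have hM0 : 0 ≤ M := (hm.trans_le (hmin hpM)).le
  have hL0 : 0 ≤ L := abs_nonneg _
  refine ⟨√M, L / m, Real.sqrt_nonneg _, div_nonneg hL0 hm.le, fun s hs y hy => ?_⟩
  have hmem : ((s, y) : ℝ × EuclideanSpace ℝ (Fin n)) ∈ C := ⟨hs, hy⟩
  have h1 : m ≤ γ (W s y) := hmin hmem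
  have h2 : γ (W s y) ≤ M := hmax hmem
  have h3 : |deriv γ (W s y) * deriv (fun s'' => W s'' y) s| ≤ L := hGmax hmem
  refine ⟨(hm.trans_le h1).le, by rwa [Real.sq_sqrt hM0], ?_⟩
  calc |deriv γ (W s y) * deriv (fun s'' => W s'' y) s| ≤ L := h3
    _ = L / m * m := by field_simp
    _ ≤ L / m * γ (W s y) := mul_le_mul_of_nonneg_left h1 (div_nonneg hL0 hm.le)

/-! ### The smooth slope function on the cone -/

/-- **Smooth slope function on a truncated solid cone.**  Let `W : ℝ → ℝⁿ → ℝ` be jointly continuous, `t₀ ≤ t`, and let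
`G : ℝ → ℝ` be real-analytic at the value `W(s, y)` of every point of the truncated solid cone
`{t₀ ≤ s ≤ t, ‖y‖ ≤ √(1+ρ²) + c(t − s) + 1}` (as `…ZShockHeightEvolution.heightEvolution_of_class_autonomy` provides when the cone's chart
image lies in a non-degenerate component `Ω`).  Then there is a GLOBALLY smooth `G̃ : ℝ → ℝ` such that at every cone point
`G̃(W) = G(W)`, `G̃'(W) = G'(W)` and `HasDerivAt G̃ (G'(W)) W` — so the autonomous height-evolution on the cone may be read with `G̃`, and
`γ = −G̃ ∈ C^∞(ℝ)` is admissible in `…ZShockWaveLocalEnergyLocal`. [folklore] -/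
theorem exists_smooth_slope_on_solidCone {W : ℝ → EuclideanSpace ℝ (Fin n) → ℝ} (hW : Continuous (uncurry W))
    {c t₀ t : ℝ} (ht : t₀ ≤ t) (ρ : ℝ) {G : ℝ → ℝ}
    (hG : ∀ s ∈ Icc t₀ t, ∀ y : EuclideanSpace ℝ (Fin n), ‖y‖ ≤ √(1 + ρ ^ 2) + c * (t - s) + 1 →
      AnalyticAt ℝ G (W s y)) :
    ∃ Gs : ℝ → ℝ, ContDiff ℝ ∞ Gs ∧
      ∀ s ∈ Icc t₀ t, ∀ y : EuclideanSpace ℝ (Fin n), ‖y‖ ≤ √(1 + ρ ^ 2) + c * (t - s) + 1 →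
        Gs (W s y) = G (W s y) ∧ deriv Gs (W s y) = deriv G (W s y) ∧ HasDerivAt Gs (deriv G (W s y)) (W s y) := by
  obtain ⟨α, β, hαβ, hrange, hsurj⟩ := exists_value_Icc_of_solidCone hW ht ρ
  have hGI : ∀ r ∈ Icc α β, AnalyticAt ℝ G r := by
    intro r hr
    obtain ⟨s, hs, y, hy, hWr⟩ := hsurj r hr
    rw [← hWr]
    exact hG s hs y hy
  obtain ⟨Gs, hGs, ε, hε, hloc⟩ := exists_contDiff_localisation hαβ hGI
  refine ⟨Gs, hGs, fun s hs y hy => ?_⟩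
  have hv := hrange s hs y hy
  exact hloc (W s y) ⟨by linarith [hv.1], by linarith [hv.2]⟩

end Summit.NavierStokesRegularity.NavierStokesRegularity.Theorems.PoloidalWindowDoorPoloidalWindowRigidityZShockConeValues

end
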